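import Summits.CriticalPhenomena.PercolationContinuityZ3.Theorems.PercNearOneGluingNoHeavyPcintChordReduction
import Literature.Probability.Percolation.SiteMonotonicity
import HarnessLib

/-!
# PCINT lane, reduction B2: `θ^site(p) ≤ N_n p^{n+1}`, `N_n` = number of `n`-step neighbour-avoiding walks

Cell `prim-pcint` (PAPER-2 track (iii): certified intervals for `p_c(ℤ^d)`), seat `prim-pcint-2`;
memo `run/shared/lean/prim/pcint/REDUCTIONS.md` §R1, §B2.  Does NOT build on p205010.

SITE percolation on `ℤ^d`: a shortest open path of the open cluster (a geodesic of the subgraph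
INDUCED by the open sites) has no lattice chord at all — both ends of a chord are open sites, so the
chord would be an edge of the induced open subgraph and would shortcut the geodesic.  Hence it is a
NEIGHBOUR-AVOIDING walk (a self-avoiding word with no chord edge), its `n + 1` sites are open with
probability `p^{n+1}`, and

  `θ^site(p) ≤ #{w ∈ sawWords d n : chordEdges w = ∅} · p^{n+1}`   (`siteTheta_le_card_nawWords_mul_pow`).

This is the reduction behind certificate kind `naw_cw` (B2) of the lane (cf. Fisher 1961 for the use
of neighbour-avoiding walks in site-percolation bounds): a finite-memory induced-walk automaton with a
Collatz–Wielandt vector gives certified lower bounds on `p_c^site(ℤ^d)` (REDUCTIONS.md §R2; second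
engine ttrl2, d = 3, memory 14: `p_c^site(ℤ³) ≥ 1/4.09969 = 0.2439`, printed best `1/4.7387 = 0.2110`).

Main results (namespace `Summit.CriticalPhenomena.PercolationContinuityZ3.Theorems.Pcint`):
* `exists_nawWord_of_sitePercolatesAt` — site percolation ⇒ for every `n` a self-avoiding word of
  length `n` with no chord edge, all of whose sites are open;
* `siteTheta_le_card_nawWords_mul_pow` — the displayed bound;
* `siteTheta_zd_eq_zero_of_naw_le_geometric`, `le_siteCriticalProb_zd_of_naw_le_geometric` — certificate glue.
-/

noncomputable section

namespace Summit.CriticalPhenomena.PercolationContinuityZ3.Theorems.Pcint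

open MeasureTheory Literature.Probability.Percolation Literature.Probability.LatticeModels

variable {d : ℕ}

/-- **A shortest open path of the site model is an induced (neighbour-avoiding) walk.** If the open
site cluster of `0` in `ℤ^d` is infinite then for every `n` there is a self-avoiding word of length
`n` with NO chord edge all of whose `n + 1` sites are open: a shortest open path to a far site of the
cluster (Mathlib `Reachable.exists_path_of_dist` in the induced open subgraph), first `n` steps; a
lattice chord between two of its (open) sites would be an open shortcut. [folklore] -/
theorem exists_nawWord_of_sitePercolatesAt {ω : SiteConfig (Site d)}
    (hC : ω ∈ sitePercolatesAt (zdGraph d) (0 : Site d)) (n : ℕ) :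
    ∃ w ∈ sawWords d n, chordEdges w = ∅ ∧ ∀ i ≤ n, wordPos w i ∈ ω := by
  classical
  have hG : siteOpenGraph (zdGraph d) ω ≤ zdGraph d := fun a b hab =>
    ((siteOpenGraph_adj _ _ _ _).1 hab).1
  have hC' : (siteCluster (zdGraph d) ω 0).Infinite := hC
  -- the finitely many endpoints of words shorter than `n`
  set S : Set (Site d) := ⋃ k : Fin n, Set.range fun w : Fin k → Fin d × Bool => wordPos w k
  have hS : S.Finite := Set.finite_iUnion fun _ => Set.finite_range _
  obtain ⟨y, hyC, hyS⟩ := (hC'.sdiff hS).nonempty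
  obtain ⟨h0, hy, hreach⟩ := hyC
  obtain ⟨r, hrp, hrl⟩ := hreach.exists_path_of_dist
  -- `r` has length at least `n`, for otherwise `y ∈ S`
  have hn : n ≤ r.length := by
    by_contra hlt
    push Not at hlt
    obtain ⟨w, hw⟩ := exists_word_of_walk hG r r.length le_rfl
    exact hyS (Set.mem_iUnion.2 ⟨⟨r.length, hlt⟩, w, by simpa using hw r.length le_rfl⟩)
  obtain ⟨w, hw⟩ := exists_word_of_walk hG r n hn
  -- every vertex of `r` is an open site
  have hopen : ∀ i ≤ r.length, r.getVert i ∈ ω := by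
    intro i hi
    rcases Nat.eq_zero_or_pos i with rfl | hpos
    · rw [SimpleGraph.Walk.getVert_zero]; exact h0
    · obtain ⟨k, rfl⟩ : ∃ k, i = k + 1 := ⟨i - 1, by omega⟩
      exact ((siteOpenGraph_adj _ _ _ _).1 (r.adj_getVert_succ (by omega : k < r.length))).2.2
  refine ⟨w, ?_, ?_, ?_⟩
  · rw [mem_sawWords]
    intro i j hi hj hij
    rw [hw i hi, hw j hj] at hij
    exact hrp.getVert_injOn (by simp; omega) (by simp; omega) hij
  · rw [Finset.eq_empty_iff_forall_notMem]
    intro e he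
    obtain ⟨i, j, hij, hjn, hadj, rfl⟩ := mem_chordEdges.1 he
    rw [hw i (by omega), hw j hjn] at hadj
    have hop : (siteOpenGraph (zdGraph d) ω).Adj (r.getVert i) (r.getVert j) :=
      (siteOpenGraph_adj _ _ _ _).2 ⟨hadj, hopen i (by omega), hopen j (hjn.trans hn)⟩
    exact Walk.not_adj_getVert_of_isGeodesic r hrl hij (hjn.trans hn) hop
  · intro i hi
    rw [hw i hi]
    exact hopen i (hi.trans hn)

/-- **Reduction B2** (`naw_cw`): `θ^site(p) ≤ N_n · p^{n+1}` for every `n`, where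
`N_n = #{w ∈ sawWords d n : chordEdges w = ∅}` is the number of `n`-step neighbour-avoiding walks
from the origin of `ℤ^d`. [folklore] -/
theorem siteTheta_le_card_nawWords_mul_pow (d n : ℕ) (p : unitInterval) :
    siteTheta (zdGraph d) 0 p ≤
      ((sawWords d n).filter fun w => chordEdges w = ∅).card * (p : ℝ) ^ (n + 1) := by
  classical
  set μ := sitePercolation (Site d) p with hμ
  set NW := (sawWords d n).filter fun w => chordEdges w = ∅ with hNW
  set sites : (Fin n → Fin d × Bool) → Finset (Site d) := fun w =>
    (Finset.range (n + 1)).image fun i => wordPos w i with hsites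
  set U : Set (SiteConfig (Site d)) := ⋃ w ∈ NW, {ω | (↑(sites w) : Set (Site d)) ⊆ ω} with hU
  have hsub : sitePercolatesAt (zdGraph d) (0 : Site d) ⊆ U := by
    intro ω hω
    obtain ⟨w, hw, hch, hop⟩ := exists_nawWord_of_sitePercolatesAt hω n
    rw [hU]
    refine Set.mem_biUnion (Finset.mem_coe.2 (Finset.mem_filter.2 ⟨hw, hch⟩)) ?_
    intro x hx
    rw [Finset.mem_coe, hsites, Finset.mem_image] at hx
    obtain ⟨i, hi, rfl⟩ := hx
    exact hop i (by simpa [Nat.lt_succ_iff] using hi)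
  have hcard : ∀ w ∈ NW, (sites w).card = n + 1 := by
    intro w hw
    have hs : IsSAW w := mem_sawWords.1 (Finset.mem_filter.1 hw).1
    rw [hsites]
    simp only
    rw [Finset.card_image_of_injOn, Finset.card_range]
    intro i hi j hj hij
    simp only [Finset.coe_range, Set.mem_Iio] at hi hj
    exact hs i j (by omega) (by omega) hij
  calc siteTheta (zdGraph d) 0 p = μ.real (sitePercolatesAt (zdGraph d) 0) := rfl
    _ ≤ μ.real U := measureReal_mono hsub (measure_ne_top μ U)
    _ ≤ ∑ w ∈ NW, μ.real {ω | (↑(sites w) : Set (Site d)) ⊆ ω} := measureReal_biUnion_finset_le _ _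
    _ = ∑ w ∈ NW, (p : ℝ) ^ (n + 1) := by
        refine Finset.sum_congr rfl fun w hw => ?_
        rw [hμ, sitePercolation_real_subset, hcard w hw]
    _ = NW.card * (p : ℝ) ^ (n + 1) := by rw [Finset.sum_const, nsmul_eq_mul]

/-! ### From a geometric bound on the neighbour-avoiding counts to `p ≤ p_c^site` -/

/-- **Certificate glue (site).** If `N_n p^{n+1} ≤ C rⁿ` for all `n` with `r < 1` (a
Collatz–Wielandt certificate for the induced-walk automaton, REDUCTIONS.md §R2), then
`θ^site(p) = 0`. [folklore] -/
theorem siteTheta_zd_eq_zero_of_naw_le_geometric (d : ℕ) (p : unitInterval) {C r : ℝ}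
    (hr0 : 0 ≤ r) (hr : r < 1)
    (h : ∀ n, ((sawWords d n).filter fun w => chordEdges w = ∅).card * (p : ℝ) ^ (n + 1) ≤ C * r ^ n) :
    siteTheta (zdGraph d) 0 p = 0 := by
  have ht : Filter.Tendsto (fun n : ℕ => C * r ^ n) Filter.atTop (nhds 0) := by
    simpa using (tendsto_pow_atTop_nhds_zero_of_lt_one hr0 hr).const_mul C
  exact le_antisymm (ge_of_tendsto' ht fun n => (siteTheta_le_card_nawWords_mul_pow d n p).trans (h n))
    measureReal_nonneg

/-- **Certificate glue (site), threshold form**: under the same hypothesis, `p ≤ p_c^site(ℤ^d)`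
(`θ^site` is non-decreasing, `siteTheta_mono`). [folklore] -/
theorem le_siteCriticalProb_zd_of_naw_le_geometric (d : ℕ) (p : unitInterval) {C r : ℝ}
    (hr0 : 0 ≤ r) (hr : r < 1)
    (h : ∀ n, ((sawWords d n).filter fun w => chordEdges w = ∅).card * (p : ℝ) ^ (n + 1) ≤ C * r ^ n) :
    (p : ℝ) ≤ siteCriticalProb (zdGraph d) 0 := by
  have h0 := siteTheta_zd_eq_zero_of_naw_le_geometric d p hr0 hr h
  refine le_csInf ⟨1, Or.inr rfl⟩ ?_
  rintro r (⟨hr, hθ⟩ | hr)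
  · by_contra hlt
    push Not at hlt
    have hmono := siteTheta_mono (G := zdGraph d) (0 : Site d)
      (show (⟨r, hr⟩ : unitInterval) ≤ p from hlt.le)
    exact hθ.not_ge (hmono.trans_eq h0)
  · rw [Set.mem_singleton_iff] at hr
    rw [hr]
    exact p.2.2

end Summit.CriticalPhenomena.PercolationContinuityZ3.Theorems.Pcint
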